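import Mathlib

/-!
# Quantitative inverse function theorem for a `C¹`-small perturbation of the identity

Stub `helper_perturbedIdentityInverse` for line `Sketch` (crux stmt-SmoothPoincare4-7826,
skeleton v16).

Let `p : ℂ → ℂ` be differentiable on the closed disc `closedBall z₀ r` with
`‖p' z - id‖ ≤ 1/2` there and `‖p z₀ - z₀‖ ≤ r/4`.  Then

* (key estimate, mean value inequality on the convex disc) `p - id` is `1/2`-Lipschitz on the
  disc, hence `‖x - y‖ ≤ 2 ‖p x - p y‖` and `p` is injective on the disc;
* (Banach fixed point) for every `y` in the quarter disc the map `T x = x - (p x - y)` is a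
  `1/2`-contraction of the (complete) closed disc into itself, so `p x = y` has a solution `q y`
  in the disc, and `q` is `2`-Lipschitz by the key estimate.
-/

set_option linter.dupNamespace false

noncomputable section

open Filter Set Metric
open scoped Topology NNReal

namespace Summit.SmoothPoincare4.SmoothPoincare4.Cruxes.TameOrBrodyR4.Sketch

namespace PerturbedIdentityInverse

/-- Key estimate: `p - id` is `1/2`-Lipschitz on the closed disc (mean value inequality on the
convex set `closedBall z₀ r`). -/
theorem norm_sub_sub_le (p : ℂ → ℂ) (p' : ℂ → (ℂ →L[ℝ] ℂ)) (z₀ : ℂ) (r : ℝ)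
    (hp : ∀ z ∈ closedBall z₀ r, HasFDerivAt p (p' z) z)
    (hd : ∀ z ∈ closedBall z₀ r, ‖p' z - ContinuousLinearMap.id ℝ ℂ‖ ≤ 1 / 2)
    {x y : ℂ} (hx : x ∈ closedBall z₀ r) (hy : y ∈ closedBall z₀ r) :
    ‖p y - p x - (y - x)‖ ≤ 1 / 2 * ‖y - x‖ := by
  have h := (convex_closedBall z₀ r).norm_image_sub_le_of_norm_hasFDerivWithin_le'
    (f := p) (f' := p') (φ := ContinuousLinearMap.id ℝ ℂ) (C := 1 / 2)
    (fun z hz => (hp z hz).hasFDerivWithinAt) hd hx hy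
  simpa using h

/-- Consequence of the key estimate: `‖y - x‖ ≤ 2 ‖p y - p x‖` on the closed disc. -/
theorem norm_sub_le_two_mul (p : ℂ → ℂ) (p' : ℂ → (ℂ →L[ℝ] ℂ)) (z₀ : ℂ) (r : ℝ)
    (hp : ∀ z ∈ closedBall z₀ r, HasFDerivAt p (p' z) z)
    (hd : ∀ z ∈ closedBall z₀ r, ‖p' z - ContinuousLinearMap.id ℝ ℂ‖ ≤ 1 / 2)
    {x y : ℂ} (hx : x ∈ closedBall z₀ r) (hy : y ∈ closedBall z₀ r) :
    ‖y - x‖ ≤ 2 * ‖p y - p x‖ := by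
  have h1 := norm_sub_sub_le p p' z₀ r hp hd hx hy
  have h2 : ‖y - x‖ ≤ ‖p y - p x‖ + ‖p y - p x - (y - x)‖ := by
    calc ‖y - x‖ = ‖(p y - p x) - (p y - p x - (y - x))‖ := by congr 1; ring
      _ ≤ ‖p y - p x‖ + ‖p y - p x - (y - x)‖ := norm_sub_le _ _
  linarith

/-- Surjectivity onto the quarter disc (Banach fixed point theorem for `T x = x - (p x - y)` on
the complete set `closedBall z₀ r`). -/
theorem exists_preimage (p : ℂ → ℂ) (p' : ℂ → (ℂ →L[ℝ] ℂ)) (z₀ : ℂ) (r : ℝ)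
    (hr : 0 < r) (hp : ∀ z ∈ closedBall z₀ r, HasFDerivAt p (p' z) z)
    (hd : ∀ z ∈ closedBall z₀ r, ‖p' z - ContinuousLinearMap.id ℝ ℂ‖ ≤ 1 / 2)
    (h0 : ‖p z₀ - z₀‖ ≤ r / 4) {y : ℂ} (hy : y ∈ closedBall z₀ (r / 4)) :
    ∃ x ∈ closedBall z₀ r, p x = y := by
  set T : ℂ → ℂ := fun x => x - (p x - y) with hT
  have hy' : ‖y - z₀‖ ≤ r / 4 := by rwa [mem_closedBall, dist_eq_norm] at hy
  have hmaps : MapsTo T (closedBall z₀ r) (closedBall z₀ r) := by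
    intro x hx
    have h1 := norm_sub_sub_le p p' z₀ r hp hd (mem_closedBall_self hr.le) hx
    rw [mem_closedBall, dist_eq_norm] at hx ⊢
    calc ‖T x - z₀‖ = ‖-(p x - p z₀ - (x - z₀)) - (p z₀ - z₀) + (y - z₀)‖ := by
          simp only [hT]; congr 1; ring
      _ ≤ ‖-(p x - p z₀ - (x - z₀))‖ + ‖p z₀ - z₀‖ + ‖y - z₀‖ := norm_add_le_of_le (norm_sub_le _ _) le_rfl
      _ = ‖p x - p z₀ - (x - z₀)‖ + ‖p z₀ - z₀‖ + ‖y - z₀‖ := by rw [norm_neg]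
      _ ≤ 1 / 2 * ‖x - z₀‖ + r / 4 + r / 4 := by gcongr
      _ ≤ 1 / 2 * r + r / 4 + r / 4 := by gcongr
      _ = r := by ring
  have hlip : LipschitzOnWith (1 / 2 : ℝ≥0) T (closedBall z₀ r) := by
    refine LipschitzOnWith.of_dist_le_mul fun x hx x' hx' => ?_
    rw [dist_eq_norm, dist_eq_norm]
    have h1 := norm_sub_sub_le p p' z₀ r hp hd hx' hx
    calc ‖T x - T x'‖ = ‖-(p x - p x' - (x - x'))‖ := by simp only [hT]; congr 1; ring
      _ = ‖p x - p x' - (x - x')‖ := norm_neg _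
      _ ≤ 1 / 2 * ‖x - x'‖ := h1
      _ = ((1 / 2 : ℝ≥0) : ℝ) * ‖x - x'‖ := by norm_num
  have hcontr : ContractingWith (1 / 2 : ℝ≥0)
      (hmaps.restrict T (closedBall z₀ r) (closedBall z₀ r)) :=
    ⟨by norm_num, hlip.mapsToRestrict hmaps⟩
  obtain ⟨x, hxs, hfix, -⟩ := ContractingWith.exists_fixedPoint' isClosed_closedBall.isComplete
    hmaps hcontr (mem_closedBall_self hr.le) (edist_ne_top _ _)
  refine ⟨x, hxs, ?_⟩
  have hx : x - (p x - y) = x := hfix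
  linear_combination (-1 : ℂ) * hx

end PerturbedIdentityInverse

open PerturbedIdentityInverse in
/-- (QI) quantitative inverse function theorem for a `C¹`-small perturbation of the identity on a
closed disc: injective, and onto the quarter disc with a Lipschitz inverse. -/
theorem helper_perturbedIdentityInverse (p : ℂ → ℂ) (p' : ℂ → (ℂ →L[ℝ] ℂ)) (z₀ : ℂ) (r : ℝ)
    (hr : 0 < r) (hp : ∀ z ∈ closedBall z₀ r, HasFDerivAt p (p' z) z)
    (hd : ∀ z ∈ closedBall z₀ r, ‖p' z - ContinuousLinearMap.id ℝ ℂ‖ ≤ 1 / 2)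
    (h0 : ‖p z₀ - z₀‖ ≤ r / 4) :
    InjOn p (closedBall z₀ r) ∧
    ∃ q : ℂ → ℂ, (∀ y ∈ closedBall z₀ (r / 4), q y ∈ closedBall z₀ r ∧ p (q y) = y) ∧
      ∀ y ∈ closedBall z₀ (r / 4), ∀ y' ∈ closedBall z₀ (r / 4), ‖q y - q y'‖ ≤ 2 * ‖y - y'‖ := by
  refine ⟨?_, ?_⟩
  · intro x hx y hy hxy
    have h := norm_sub_le_two_mul p p' z₀ r hp hd hx hy
    rw [hxy, sub_self, norm_zero, mul_zero] at h
    exact (sub_eq_zero.mp (norm_le_zero_iff.mp h)).symm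
  · have hex : ∀ y ∈ closedBall z₀ (r / 4), ∃ x ∈ closedBall z₀ r, p x = y :=
      fun y hy => exists_preimage p p' z₀ r hr hp hd h0 hy
    choose! q hq using hex
    refine ⟨q, fun y hy => hq y hy, fun y hy y' hy' => ?_⟩
    have h := norm_sub_le_two_mul p p' z₀ r hp hd (hq y' hy').1 (hq y hy).1
    rwa [(hq y hy).2, (hq y' hy').2] at h

end Summit.SmoothPoincare4.SmoothPoincare4.Cruxes.TameOrBrodyR4.Sketch
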